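import Literature.AlgebraicGeometry.RelativeSpec.GeometricQuotientFreeTorsor
import HarnessLib

/-!
# The torsor property of a free finite quotient on `T`-valued points, locally on an ARBITRARY `T`

Topic `AlgebraicGeometry/RelativeSpec`; namespace `Literature.AlgebraicGeometry.RelativeSpec.ActionOver.IsGeometricQuotient`.
THEOREMS ONLY (no definition, no named fact, no instance, no notation, no `sorry`; net Literature debt 0).

[SGA1] Exp. V Prop. 2.6 (iii) / Déf. 2.7: for a free action of the finite group `G` on `X` with affine geometric quotient
`p : X → Q`, «`X` est formellement principal homogène sous `G_Q`»: `X × G ⥲ X ×_Q X`.  Read on `T`-valued points: two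
morphisms `t₁, t₂ : T → X` with `t₁ ≫ p = t₂ ≫ p` differ, LOCALLY ON `T`, by an element of `G`.  ★
`GeometricQuotientFreeTorsor.existsUnique_eq_comp_aut_of_comp_eq_of_connectedSpace` is the statement for CONNECTED `T` (then
one `g` serves globally); THIS FILE is the statement for arbitrary `T`:

* `exists_openCover_eq_comp_aut_of_comp_eq` — there is an open cover `𝒱` of `T` (indexed in the universe of `T`) and, for every member `j`, an element
  `g_j ∈ G` with `𝒱.f j ≫ t₂ = 𝒱.f j ≫ t₁ ≫ σ_{g_j}`: the pair `(t₁, t₂) : T → X ×_Q X` is covered by the preimages of the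
  (open, ★ `isOpenImmersion_graph`; jointly surjective, ★ `iUnion_range_graph_eq_univ_of_free`) graphs `γ_g`, and on each
  preimage it factors through `γ_g` (Mathlib `IsOpenImmersion.lift`);

Cell `hodgecm-mathlib` (D-0151), FLOOR 0 programme P1, F-3 (M) child line `Cruxes/HDel/Lines/F3DualAbelianSchemeM`, letter (Mb)
`stub_F3Mb` (KERNEL clause of `π : A′ → A′⁄K′` on all `T`-points: `u ≫ π = 1 ⇒ u` is locally a section of `K′`).
Count-neutral; HC_CM is proved only modulo the 7 printed citations until rung 0 closes; nothing here is about HC.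

Mathlib searched (pin): `Scheme.Cover.mkOfCovers`, `Scheme.Opens.ι_apply`, `IsOpenImmersion.lift_fac`, `Scheme.Hom.opensRange`
(used); Mathlib has torsors for group objects but no quotients of schemes by finite groups.

## References
* [SGA1] A. Grothendieck, *SGA 1*, Exp. V, Prop. 2.6 (iii), Déf. 2.7.
* [MumfordAV1970] D. Mumford, *Abelian Varieties* (1970), §7 Thm. p. 66 (1), Thm. 4 (p. 72).
-/

set_option autoImplicit false

noncomputable section

universe u

open CategoryTheory Limits AlgebraicGeometry TopologicalSpace Opposite

namespace Literature.AlgebraicGeometry.RelativeSpec.ActionOver.IsGeometricQuotient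

variable {X Q : Scheme.{u}} {p : X ⟶ Q} {G : Type u} [Group G] {ρ : ActionOver p G}
  (hq : ρ.IsGeometricQuotient p) [Fintype G] [IsAffineHom p]
  (hfree : ∀ (V : Q.Opens), IsAffineOpen V → ∀ g : G, g ≠ 1 →
    Ideal.span (Set.range fun b : Γ(X, p ⁻¹ᵁ V) ↦ ρ.act g V b - b) = ⊤)

set_option backward.isDefEq.respectTransparency false

include hq hfree

/-- **The torsor property on `T`-points, locally on `T`.**  For a free affine geometric quotient `p : X → Q` by the finite
group `G` and ANY scheme `T`, two morphisms `t₁ t₂ : T → X` with `t₁ ≫ p = t₂ ≫ p` differ locally on `T` by an element of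
`G`: there is an open cover `𝒱` of `T` with `𝒱.f j ≫ t₂ = 𝒱.f j ≫ t₁ ≫ σ_{g_j}` for suitable `g_j ∈ G`.  (The pair
`(t₁, t₂) : T → X ×_Q X` meets only the clopen graphs `γ_g ≅ X` of the elements of `G` — ★ `iUnion_range_graph_eq_univ_of_free`
— and on the preimage of `γ_g(X)` it factors through the open immersion `γ_g`, ★ `isOpenImmersion_graph`.)  SGA 1 V 2.6 (iii)
«formellement principal homogène» read on `T`-points; ★ `existsUnique_eq_comp_aut_of_comp_eq_of_connectedSpace` is the
connected case. [cite: SGA1, Exp. V Prop. 2.6 (iii), Déf. 2.7] [cite: MumfordAV1970, §7 Thm. p. 66] -/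
theorem exists_openCover_eq_comp_aut_of_comp_eq {T : Scheme.{u}} (t₁ t₂ : T ⟶ X) (h : t₁ ≫ p = t₂ ≫ p) :
    ∃ 𝒱 : Scheme.OpenCover.{u} T, ∀ j, ∃ g : G, 𝒱.f j ≫ t₂ = 𝒱.f j ≫ t₁ ≫ (ρ.aut g).hom := by
  classical
  haveI : Etale p := hq.etale_of_free hfree
  -- the graphs `γ_g = (1, g) : X → X ×_Q X`, open immersions
  let γ : G → (X ⟶ pullback p p) := fun g =>
    pullback.lift (𝟙 X) (ρ.aut g).hom (by rw [Category.id_comp, hq.comp_eq])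
  haveI : ∀ g : G, IsOpenImmersion (γ g) := fun g => hq.isOpenImmersion_graph g
  -- the pair `(t₁, t₂)` and, for each point of `T`, a graph through its image
  let L : T ⟶ pullback p p := pullback.lift t₁ t₂ h
  have hpt : ∀ τ : T, ∃ g : G, L τ ∈ Set.range (γ g) := fun τ =>
    Set.mem_iUnion.mp (Set.eq_univ_iff_forall.mp (hq.iUnion_range_graph_eq_univ_of_free hfree) (L τ))
  choose g hg using hpt
  -- the open pieces `(t₁, t₂)⁻¹(γ_{g τ}(X))`
  let U : T → T.Opens := fun τ => L ⁻¹ᵁ (γ (g τ)).opensRange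
  have hU : ∀ τ : T, τ ∈ U τ := fun τ => hg τ
  refine ⟨Scheme.Cover.mkOfCovers (P := @IsOpenImmersion) (T : Type u) (fun τ => ((U τ : T.Opens) : Scheme.{u}))
    (fun τ => (U τ).ι) (fun τ => ⟨τ, ⟨τ, hU τ⟩, rfl⟩) inferInstance, fun τ => ⟨g τ, ?_⟩⟩
  change (U τ).ι ≫ t₂ = (U τ).ι ≫ t₁ ≫ (ρ.aut (g τ)).hom
  -- on the piece, `(t₁, t₂)` lands in the graph of `g τ`, hence factors through it
  have hrange : Set.range ((U τ).ι ≫ L) ⊆ Set.range (γ (g τ)) := by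
    rintro _ ⟨x, rfl⟩
    rw [Scheme.Hom.comp_apply, Scheme.Opens.ι_apply]
    exact x.2
  have hs := IsOpenImmersion.lift_fac (γ (g τ)) ((U τ).ι ≫ L) hrange
  have h1 : IsOpenImmersion.lift (γ (g τ)) ((U τ).ι ≫ L) hrange = (U τ).ι ≫ t₁ := by
    have e := congrArg (· ≫ pullback.fst p p) hs
    simpa only [γ, L, Category.assoc, pullback.lift_fst, Category.comp_id] using e
  have h2 := congrArg (· ≫ pullback.snd p p) hs
  simp only [γ, L, Category.assoc, pullback.lift_snd, h1] at h2
  exact h2.symm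

end Literature.AlgebraicGeometry.RelativeSpec.ActionOver.IsGeometricQuotient

end
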